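import Mathlib.Analysis.Fourier.FourierTransformDeriv
import Literature.NumberTheory.LFunctions.DedekindZetaPoissonProofs
import Literature.NumberTheory.LFunctions.DedekindZetaThetaProofs
import Literature.NumberTheory.Sieve.NumberFieldLargeSieveCharacters
import HarnessLib

/-!
# Smooth sums over cosets of ideals in a totally real field (Poisson summation)

Topic `Literature/NumberTheory/Sieve`, sub-namespace `SmoothCoset`. The "type I" input for a
Bombieri–Vinogradov theorem over a totally real number field `K` of degree `d` (Hinz 1988 uses
the Pólya–Vinogradov inequality of his reference [9] at this point; with SMOOTH weights the
Poisson summation formula gives a stronger and more elementary substitute). For a product weight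
`F(x) = ∏_w g_w(x_w)` on `ℝ^{d}` (`w` running over the real places, `g_w ∈ C^m_c(ℝ)`), a nonzero
ideal `𝔞`, a scale `Y > 0` and any `β ∈ 𝓞_K`,

  `∑_{a ∈ 𝔞} F(σ(a + β)/Y) = (∏_w ∫ g_w) · Y^d/(N𝔞 √|d_K|) + O_{K,m}(G^d (Y^d/N𝔞) R^{-(m-1)})`,

`R = Y^d/(N𝔞 N𝔡)`, uniformly in `β`, where `G` bounds the Fourier transforms
`|ĝ_w(τ)| ≤ G min(1, |τ|^{-m})` (`SmoothCoset.coset_sum`). Ingredients, all PROVED here: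

* `norm_fourier_le_dec` — `|ĝ(τ)| ≤ max(‖g‖₁, ‖g^{(m)}‖₁/(2π)^m) · min(1,|τ|^{-m})` for
  `g ∈ C^m_c(ℝ)` (Mathlib `Real.fourier_iteratedDeriv`);
* `card_box_le` — an elementary lattice-point bound: in an additive subgroup `S ⊆ K` whose nonzero
  elements have `|N(x)| ≥ ν`, a box `|x_w| ≤ T_w` with `∏ T_w ≥ ν` contains at most
  `2^{2d+1} ∏ T_w/ν` points of `S` (pigeonhole on sub-boxes of volume `< ν`), and no nonzero point
  if `∏ T_w < ν` (`eq_zero_of_prod_lt`);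
* `sum_prod_dec_le` — hence `∑_{0 ≠ x ∈ S} ∏_w min(1,(Y|x_w|)^{-m}) ≤ 2^{md+3d+1} R^{-(m-1)}`,
  `R = Y^d ν ≥ 1` (dyadic decomposition);
* `fourier_prodWeight` — `𝓕(F ∘ toMixed)(ξ) = ∏_w ĝ_w(ξ_w)` on the euclidean Minkowski space of a
  totally real field;
* `coset_sum` — Poisson summation (tree `Fourier.tsum_eq_tsum_fourier_of_rpow_decay`, Neukirch VII
  (3.2)) on the scaled ideal lattice `Y⁻¹ j(𝔞)` (tree `scaledIdealLattice`, covolume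
  `N𝔞 √|d_K| / Y^d`, dual lattice `= Y · j((𝔞𝔡)⁻¹)`, `dualIdealEquivDualLattice`), the dual sum
  being estimated by `sum_prod_dec_le` with `ν = (N𝔞 N𝔡)⁻¹`
  (`NumberFieldLS.inv_absNorm_le_abs_norm_of_mem_inv`, `dual_coeIdeal_eq_inv`);
* `charSum_ideal_le` — the type I estimate: for `(𝔟, 𝔣) = 1` and `χ ≠ χ₀` mod `𝔣`,
  `|∑_{a ∈ 𝔟} χ(a) F(σ(a)/Y)| ≤ N𝔣 · (error term of coset_sum for 𝔟𝔣)` (classes of `𝔟` mod `𝔟𝔣`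
  are all classes mod `𝔣`; the main terms cancel since `∑_q χ(q) = 0`).

Definitions (with bodies): `dec`, `bucket`, `prodWeight`, `testFn`, `DualElts`, `idealEquivCoe`.

## References

* J. Hinz, *A generalization of Bombieri's prime number theorem to algebraic number fields*,
  Acta Arith. 51 (1988), §4 (treatment of `S₂`, `S₃`). [cite: Hinz1988, §4]
* J. Neukirch, *Algebraic Number Theory*, Ch. VII (3.2) (Poisson summation), (5.7) (dual lattice of
  an ideal). [cite: NeukirchANT1999, Ch. VII (3.2), (5.7)]
-/

noncomputable section

open MeasureTheory NumberField NumberField.InfinitePlace NumberField.mixedEmbedding Finset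
  Literature.NumberTheory.LFunctions.NumberField Literature.NumberTheory.Sieve.NumberFieldLS
open scoped Real FourierTransform Classical nonZeroDivisors

namespace Literature.NumberTheory.Sieve.SmoothCoset

/-! ## One-dimensional Fourier decay -/

section OneDim

/-- The decay profile `min(1, |τ|^{-m}) = (max(1,|τ|))^{-m}`. [folklore] -/
def dec (m : ℕ) (τ : ℝ) : ℝ := ((max 1 |τ|) ^ m)⁻¹

/-- `dec > 0`. [folklore] -/
theorem dec_pos (m : ℕ) (τ : ℝ) : 0 < dec m τ := by
  unfold dec; positivity

/-- `dec ≥ 0`. [folklore] -/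
theorem dec_nonneg (m : ℕ) (τ : ℝ) : 0 ≤ dec m τ := (dec_pos m τ).le

/-- `dec ≤ 1`. [folklore] -/
theorem dec_le_one (m : ℕ) (τ : ℝ) : dec m τ ≤ 1 := by
  unfold dec
  exact inv_le_one_of_one_le₀ (one_le_pow₀ (le_max_left _ _))

/-- `dec = 1` on `[-1, 1]`. [folklore] -/
theorem dec_of_abs_le_one {m : ℕ} {τ : ℝ} (h : |τ| ≤ 1) : dec m τ = 1 := by
  simp [dec, max_eq_left h]

/-- `dec ≤ |τ|^{-m}`. [folklore] -/
theorem dec_le_inv_pow (m : ℕ) {τ : ℝ} (hτ : τ ≠ 0) : dec m τ ≤ (|τ| ^ m)⁻¹ := by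
  unfold dec
  exact inv_anti₀ (pow_pos (abs_pos.2 hτ) _) (pow_le_pow_left₀ (abs_nonneg _) (le_max_right _ _) _)

/-- `dec` is antitone in `|τ|`: if `a ≤ |τ|` with `1 ≤ a` then `dec m τ ≤ (a^m)⁻¹`. [folklore] -/
theorem dec_le_of_le_abs {m : ℕ} {a τ : ℝ} (ha : 0 < a) (h : a ≤ |τ|) : dec m τ ≤ (a ^ m)⁻¹ := by
  unfold dec
  exact inv_anti₀ (pow_pos ha _) (pow_le_pow_left₀ ha.le (h.trans (le_max_right _ _)) _)

variable {g : ℝ → ℂ}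

/-- `|ĝ(τ)| ≤ ‖g‖₁`. [folklore] -/
theorem norm_fourier_le_integral (g : ℝ → ℂ) (τ : ℝ) : ‖𝓕 g τ‖ ≤ ∫ x, ‖g x‖ :=
  VectorFourier.norm_fourierIntegral_le_integral_norm 𝐞 volume (innerₗ ℝ) g τ

/-- Iterated derivatives of compactly supported functions are compactly supported. [folklore] -/
theorem hasCompactSupport_iteratedDeriv (hg : HasCompactSupport g) (n : ℕ) :
    HasCompactSupport (iteratedDeriv n g) := by
  induction n with
  | zero => simpa using hg
  | succ n ih => rw [iteratedDeriv_succ]; exact ih.deriv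

/-- Iterated derivatives of `C^m_c` functions are integrable. [folklore] -/
theorem integrable_iteratedDeriv {m : ℕ} (hg : ContDiff ℝ m g) (hs : HasCompactSupport g) {n : ℕ}
    (hn : n ≤ m) : Integrable (iteratedDeriv n g) :=
  (hg.continuous_iteratedDeriv n (by exact_mod_cast hn)).integrable_of_hasCompactSupport
    (hasCompactSupport_iteratedDeriv hs n)

/-- `|ĝ(τ)| ≤ ‖g^{(m)}‖₁ / (2π|τ|)^m` for `g ∈ C^m_c(ℝ)`, `τ ≠ 0` (integration by parts `m` times,
Mathlib `Real.fourier_iteratedDeriv`). [folklore] -/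
theorem norm_fourier_le_of_iteratedDeriv {m : ℕ} (hg : ContDiff ℝ m g) (hs : HasCompactSupport g)
    {τ : ℝ} (hτ : τ ≠ 0) :
    ‖𝓕 g τ‖ ≤ (∫ x, ‖iteratedDeriv m g x‖) / (2 * π * |τ|) ^ m := by
  have h := Real.fourier_iteratedDeriv (N := (m : ℕ∞)) (n := m) hg
    (fun n hn => integrable_iteratedDeriv hg hs (by exact_mod_cast hn)) le_rfl
  have h1 : 𝓕 (iteratedDeriv m g) τ = (2 * π * Complex.I * τ) ^ m • 𝓕 g τ := congrFun h τ
  have hpos : 0 < (2 * π * |τ|) ^ m := pow_pos (by positivity) _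
  have hnorm : ‖(2 * π * Complex.I * τ : ℂ) ^ m‖ = (2 * π * |τ|) ^ m := by
    rw [norm_pow]
    congr 1
    simp [abs_of_pos Real.pi_pos]
  rw [le_div_iff₀ hpos, mul_comm, ← hnorm, ← _root_.norm_smul, ← h1]
  exact norm_fourier_le_integral _ _

/-- **Fourier decay of a `C^m_c` function**: `|ĝ(τ)| ≤ G · min(1, |τ|^{-m})` with
`G = max(‖g‖₁, ‖g^{(m)}‖₁/(2π)^m)`. [folklore] -/
theorem norm_fourier_le_dec {m : ℕ} (hg : ContDiff ℝ m g) (hs : HasCompactSupport g) (τ : ℝ) :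
    ‖𝓕 g τ‖ ≤ max (∫ x, ‖g x‖) ((∫ x, ‖iteratedDeriv m g x‖) / (2 * π) ^ m) * dec m τ := by
  by_cases hτ : |τ| ≤ 1
  · rw [dec_of_abs_le_one hτ, mul_one]
    exact (norm_fourier_le_integral g τ).trans (le_max_left _ _)
  · push Not at hτ
    have hτ0 : τ ≠ 0 := by rintro rfl; norm_num at hτ
    have hdec : dec m τ = (|τ| ^ m)⁻¹ := by
      simp [dec, max_eq_right hτ.le]
    rw [hdec]
    calc ‖𝓕 g τ‖ ≤ (∫ x, ‖iteratedDeriv m g x‖) / (2 * π * |τ|) ^ m :=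
          norm_fourier_le_of_iteratedDeriv hg hs hτ0
      _ = (∫ x, ‖iteratedDeriv m g x‖) / (2 * π) ^ m * (|τ| ^ m)⁻¹ := by
          rw [mul_pow, div_mul_eq_div_div, div_eq_mul_inv _ (|τ| ^ m)]
      _ ≤ _ := by
          gcongr
          exact le_max_right _ _

end OneDim

/-! ## Lattice points of norm-separated subgroups in boxes -/

section Boxes

variable {K : Type*} [Field K] [NumberField K] [IsTotallyReal K]

local notation "d" => Module.finrank ℚ K

/-- The real places of a totally real field, as an index type. -/
local notation "RP" => {w : InfinitePlace K // IsReal w}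

omit [IsTotallyReal K] in
/-- `#{real places} = d`. [folklore] -/
theorem card_RP_eq [IsTotallyReal K] : Fintype.card RP = d := card_realPlaces (K := K)

/-- A number field has a real place when it is totally real. [folklore] -/
instance nonempty_RP : Nonempty RP :=
  let ⟨w⟩ := (inferInstance : Nonempty (InfinitePlace K)); ⟨⟨w, IsTotallyReal.isReal w⟩⟩

/-- **Pigeonhole in a box.** Let `S ⊆ K` be closed under subtraction and suppose every nonzero
`x ∈ S` has `|N(x)| ≥ ν > 0`. If `A ⊆ S` is a finite set of points with `|σ_w(x)| ≤ T_w` for all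
real places `w`, and `ν ≤ ∏_w T_w`, then `#A ≤ 2^{2d+1} (∏_w T_w)/ν`: subdivide the box into
cells of side `2T_w ρ`, `ρ = (ν / (2^{d+1} ∏ T_w))^{1/d}`; two points of `A` in one cell differ by
an element of `S` of norm `< ∏_w 2 T_w ρ = ν/2`, hence coincide. [folklore] -/
theorem card_box_le {S : Set K} (hS : ∀ x ∈ S, ∀ y ∈ S, x - y ∈ S) {ν : ℝ} (hν : 0 < ν)
    (hnorm : ∀ x ∈ S, x ≠ 0 → ν ≤ |((Algebra.norm ℚ x : ℚ) : ℝ)|)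
    {T : RP → ℝ} (hT : ∀ w, 0 < T w) (hνT : ν ≤ ∏ w, T w)
    (A : Finset K) (hAS : ∀ x ∈ A, x ∈ S) (hAT : ∀ x ∈ A, ∀ w, |remb K x w| ≤ T w) :
    (A.card : ℝ) ≤ 2 ^ (2 * d + 1) * (∏ w, T w) / ν := by
  have hd : 0 < d := Module.finrank_pos
  set P : ℝ := ∏ w, T w with hP
  have hPpos : 0 < P := prod_pos fun w _ => hT w
  -- `u = 2^{d+1} P / ν ≥ 2`, `ρ = u^{-1/d}`
  set u : ℝ := 2 ^ (d + 1) * P / ν with hu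
  have hu1 : 1 ≤ u := by
    rw [hu, le_div_iff₀ hν, one_mul]
    calc ν ≤ P := hνT
      _ = 1 * P := (one_mul _).symm
      _ ≤ 2 ^ (d + 1) * P := by gcongr; exact one_le_pow₀ (by norm_num)
  have hupos : 0 < u := by linarith
  set ρ : ℝ := u ^ (-(1 : ℝ) / d) with hρ
  have hρpos : 0 < ρ := Real.rpow_pos_of_pos hupos _
  have hρle : ρ ≤ 1 := by
    rw [hρ]
    exact Real.rpow_le_one_of_one_le_of_nonpos hu1
      (div_nonpos_of_nonpos_of_nonneg (by norm_num) (Nat.cast_nonneg _))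
  have hρd : ρ ^ d = u⁻¹ := by
    rw [hρ, ← Real.rpow_natCast, ← Real.rpow_mul hupos.le, neg_div, neg_mul,
      div_mul_cancel₀ _ (by exact_mod_cast hd.ne'), Real.rpow_neg hupos.le, Real.rpow_one]
  -- cell sides `s_w = 2 T_w ρ`, `∏ s_w = ν / 2 < ν`
  set s : RP → ℝ := fun w => 2 * T w * ρ with hs
  have hspos : ∀ w, 0 < s w := fun w => mul_pos (mul_pos two_pos (hT w)) hρpos
  have hprods : ∏ w, s w = ν / 2 := by
    simp only [hs]
    rw [prod_mul_distrib, prod_mul_distrib, prod_const, prod_const, card_univ, card_RP_eq, hρd,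
      hu, ← hP]
    field_simp
    ring
  -- the grid map
  let J : K → RP → ℕ := fun x w => ⌊(remb K x w + T w) / s w⌋₊
  let M : RP → ℕ := fun w => ⌊2 * T w / s w⌋₊
  have hJmem : ∀ x ∈ A, J x ∈ Fintype.piFinset fun w => range (M w + 1) := by
    intro x hx
    rw [Fintype.mem_piFinset]
    intro w
    rw [mem_range, Nat.lt_succ_iff]
    apply Nat.floor_le_floor
    have h1 := hAT x hx w
    rw [abs_le] at h1
    gcongr
    · exact (hspos w).le
    · linarith [h1.2]
  have hJinj : Set.InjOn J A := by
    intro x hx y hy hxy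
    by_contra hne
    have hsub : x - y ∈ S := hS x (hAS x hx) y (hAS y hy)
    have hne0 : x - y ≠ 0 := sub_ne_zero.2 hne
    have hlow := hnorm _ hsub hne0
    -- each coordinate of `x - y` is `< s w` in absolute value
    have hcoord : ∀ w, |remb K (x - y) w| < s w := by
      intro w
      have h := congrFun hxy w
      simp only [J] at h
      have hx0 : 0 ≤ (remb K x w + T w) / s w :=
        div_nonneg (by linarith [(abs_le.1 (hAT x hx w)).1]) (hspos w).le
      have hy0 : 0 ≤ (remb K y w + T w) / s w :=
        div_nonneg (by linarith [(abs_le.1 (hAT y hy w)).1]) (hspos w).le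
      have h1 := Nat.floor_eq_iff hx0 |>.1 rfl
      have h2 := Nat.floor_eq_iff hy0 |>.1 rfl
      rw [h] at h1
      have hlt : |(remb K x w + T w) / s w - (remb K y w + T w) / s w| < 1 := by
        rw [abs_lt]; constructor <;> linarith [h1.1, h1.2, h2.1, h2.2]
      rw [← sub_div, abs_div, abs_of_pos (hspos w), div_lt_one (hspos w)] at hlt
      have hrw : remb K x w + T w - (remb K y w + T w) = remb K x w - remb K y w := by ring
      rw [hrw] at hlt
      rw [remb_sub, Pi.sub_apply]
      exact hlt
    have hprod : |((Algebra.norm ℚ (x - y) : ℚ) : ℝ)| < ν := by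
      rw [abs_norm_eq_prod_abs_remb]
      calc ∏ w, |remb K (x - y) w| < ∏ w, s w := by
            apply prod_lt_prod_of_nonempty
            · intro w _
              exact abs_pos.2 (remb_apply_ne_zero K hne0 w)
            · intro w _; exact hcoord w
            · exact univ_nonempty
        _ = ν / 2 := hprods
        _ < ν := by linarith
    linarith
  -- count
  have hcard : A.card ≤ (Fintype.piFinset fun w => range (M w + 1)).card :=
    card_le_card_of_injOn J hJmem hJinj
  rw [Fintype.card_piFinset] at hcard
  simp only [card_range] at hcard
  have hM : ∀ w, ((M w + 1 : ℕ) : ℝ) ≤ 2 * ρ⁻¹ := by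
    intro w
    have h1 : (M w : ℝ) ≤ 2 * T w / s w :=
      Nat.floor_le (div_nonneg (by linarith [hT w]) (hspos w).le)
    have h2 : 2 * T w / s w = ρ⁻¹ := by
      have hTw : T w ≠ 0 := (hT w).ne'
      rw [hs]; field_simp
    push_cast
    rw [h2] at h1
    have h3 : (1 : ℝ) ≤ ρ⁻¹ := one_le_inv_iff₀.2 ⟨hρpos, hρle⟩
    linarith
  calc (A.card : ℝ) ≤ ((∏ w, (M w + 1) : ℕ) : ℝ) := by exact_mod_cast hcard
    _ = ∏ w, ((M w + 1 : ℕ) : ℝ) := by push_cast; rfl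
    _ ≤ ∏ w : RP, 2 * ρ⁻¹ := prod_le_prod (fun w _ => by positivity) fun w _ => hM w
    _ = 2 ^ d * u := by
        rw [prod_const, card_univ, card_RP_eq, mul_pow, inv_pow, hρd, inv_inv]
    _ = 2 ^ (2 * d + 1) * P / ν := by
        rw [hu]; ring

/-- **No nonzero point of small norm in a small box**: if `x ∈ S`, `x ≠ 0` would force
`|N x| ≥ ν`, then `|σ_w x| ≤ T_w` with `∏ T_w < ν` forces `x = 0`. [folklore] -/
theorem eq_zero_of_prod_lt {S : Set K} {ν : ℝ}
    (hnorm : ∀ x ∈ S, x ≠ 0 → ν ≤ |((Algebra.norm ℚ x : ℚ) : ℝ)|)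
    {T : RP → ℝ} (hνT : ∏ w, T w < ν) {x : K} (hx : x ∈ S)
    (hxT : ∀ w, |remb K x w| ≤ T w) : x = 0 := by
  by_contra h0
  have h := hnorm x hx h0
  rw [abs_norm_eq_prod_abs_remb] at h
  have : ∏ w, |remb K x w| ≤ ∏ w, T w := prod_le_prod (fun w _ => abs_nonneg _) fun w _ => hxT w
  linarith

/-! ### The dyadic sum `∑_{x ≠ 0} ∏_w min(1, (Y|x_w|)^{-m})` -/

/-- The dyadic bucket of a real number at scale `Y`: the least `j` with `Y|t| ≤ 2^j`. [folklore] -/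
def bucket (Y t : ℝ) : ℕ := Nat.clog 2 ⌈Y * |t|⌉₊

/-- `Y|t| ≤ 2^{bucket}`. [folklore] -/
theorem mul_abs_le_two_pow_bucket (Y t : ℝ) : Y * |t| ≤ 2 ^ bucket Y t := by
  unfold bucket
  calc Y * |t| ≤ (⌈Y * |t|⌉₊ : ℝ) := Nat.le_ceil _
    _ ≤ ((2 ^ Nat.clog 2 ⌈Y * |t|⌉₊ : ℕ) : ℝ) := by exact_mod_cast Nat.le_pow_clog (by norm_num) _
    _ = 2 ^ Nat.clog 2 ⌈Y * |t|⌉₊ := by push_cast; rfl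

/-- `2^{bucket - 1} < Y|t|` for a positive bucket. [folklore] -/
theorem two_pow_bucket_lt {Y t : ℝ} (h : 1 ≤ bucket Y t) :
    (2 : ℝ) ^ (bucket Y t - 1) < Y * |t| := by
  have h1 : 2 ^ (bucket Y t - 1) < ⌈Y * |t|⌉₊ := by
    unfold bucket at *
    exact Nat.pow_pred_clog_lt_self (by norm_num) (by
      by_contra h0; push Not at h0
      interval_cases (⌈Y * |t|⌉₊) <;> simp at h)
  have h2 : ((2 ^ (bucket Y t - 1) : ℕ) : ℝ) + 1 ≤ ⌈Y * |t|⌉₊ := by exact_mod_cast h1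
  have h3 := Nat.ceil_lt_add_one (show 0 ≤ Y * |t| from by
    by_contra hneg; push Not at hneg
    have : ⌈Y * |t|⌉₊ = 0 := Nat.ceil_eq_zero.2 hneg.le
    unfold bucket at h; rw [this] at h; simp at h)
  push_cast at h2
  linarith

/-- `min(1,(Y|t|)^{-m}) ≤ 2^m 2^{-m·bucket}`. [folklore] -/
theorem dec_mul_le_bucket (m : ℕ) {Y : ℝ} (hY : 0 < Y) (t : ℝ) :
    dec m (Y * t) ≤ 2 ^ m * ((2 : ℝ) ^ (m * bucket Y t))⁻¹ := by
  rcases Nat.eq_zero_or_pos (bucket Y t) with h0 | hpos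
  · rw [h0, mul_zero, pow_zero, inv_one, mul_one]
    exact (dec_le_one _ _).trans (one_le_pow₀ (by norm_num))
  · have hlt := two_pow_bucket_lt (Y := Y) (t := t) hpos
    have hle : (2 : ℝ) ^ (bucket Y t - 1) ≤ |Y * t| := by
      rw [abs_mul, abs_of_pos hY]; exact hlt.le
    calc dec m (Y * t) ≤ ((2 ^ (bucket Y t - 1)) ^ m)⁻¹ := dec_le_of_le_abs (by positivity) hle
      _ = 2 ^ m * ((2 : ℝ) ^ (m * bucket Y t))⁻¹ := by
          obtain ⟨b, hb⟩ : ∃ b, bucket Y t = b + 1 := ⟨bucket Y t - 1, by omega⟩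
          rw [hb, Nat.add_sub_cancel, ← pow_mul, show m * (b + 1) = b * m + m by ring, pow_add,
            mul_inv, ← mul_assoc, mul_comm ((2 : ℝ) ^ m) _, mul_assoc,
            mul_inv_cancel₀ (by positivity), mul_one, mul_comm]

/-- Sum of the exponents of a bucket vector. -/
local notation "wt" j => (∑ w, j w : ℕ)

/-- `∑_{i < n} 2^{-i} ≤ 2`. [folklore] -/
theorem sum_range_half_pow_le (n : ℕ) : ∑ i ∈ range n, ((2 : ℝ) ^ i)⁻¹ ≤ 2 := by
  have h : ∑ i ∈ range n, ((2 : ℝ) ^ i)⁻¹ = ∑ i ∈ range n, (1 / 2 : ℝ) ^ i := by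
    refine sum_congr rfl fun i _ => ?_
    rw [one_div, inv_pow]
  rw [h, geom_sum_eq (by norm_num) n]
  have h2 : (0 : ℝ) ≤ (1 / 2) ^ n := by positivity
  have h3 : ((1 / 2 : ℝ) ^ n - 1) / (1 / 2 - 1) = 2 - 2 * (1 / 2) ^ n := by ring
  rw [h3]
  linarith

/-- `∑_{j ∈ J} 2^{-|j|} ≤ 2^d` for any finite set `J` of exponent vectors. [folklore] -/
theorem sum_inv_two_pow_wt_le (Js : Finset (RP → ℕ)) :
    ∑ j ∈ Js, ((2 : ℝ) ^ (wt j))⁻¹ ≤ 2 ^ d := by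
  -- enlarge to a full grid `{0, …, N}^{RP}`
  obtain ⟨N, hN⟩ : ∃ N : ℕ, ∀ j ∈ Js, ∀ w, j w ≤ N := by
    refine ⟨Js.sup fun j => univ.sup j, fun j hj w => ?_⟩
    have h1 : j w ≤ univ.sup j := Finset.le_sup (f := j) (mem_univ w)
    have h2 : univ.sup j ≤ Js.sup fun j => univ.sup j :=
      Finset.le_sup (f := fun j : RP → ℕ => univ.sup j) hj
    exact h1.trans h2
  have hsub : Js ⊆ Fintype.piFinset fun _ : RP => range (N + 1) := by
    intro j hj
    rw [Fintype.mem_piFinset]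
    intro w
    rw [mem_range, Nat.lt_succ_iff]
    exact hN j hj w
  calc ∑ j ∈ Js, ((2 : ℝ) ^ (wt j))⁻¹
      ≤ ∑ j ∈ Fintype.piFinset fun _ : RP => range (N + 1), ((2 : ℝ) ^ (wt j))⁻¹ :=
        sum_le_sum_of_subset_of_nonneg hsub fun _ _ _ => by positivity
    _ = ∑ j ∈ Fintype.piFinset fun _ : RP => range (N + 1), ∏ w, ((2 : ℝ) ^ (j w))⁻¹ := by
        refine sum_congr rfl fun j _ => ?_
        rw [← prod_pow_eq_pow_sum, prod_inv_distrib]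
    _ = ∏ _w : RP, ∑ i ∈ range (N + 1), ((2 : ℝ) ^ i)⁻¹ :=
        (prod_univ_sum (fun _ : RP => range (N + 1)) (fun _ i => ((2 : ℝ) ^ i)⁻¹)).symm
    _ ≤ ∏ _w : RP, (2 : ℝ) := prod_le_prod (fun _ _ => sum_nonneg fun _ _ => by positivity)
        fun _ _ => sum_range_half_pow_le _
    _ = 2 ^ d := by rw [prod_const, card_univ, card_RP_eq]

/-- **The dual-lattice sum.** Let `S ⊆ K` be closed under subtraction with `|N x| ≥ ν` for
`0 ≠ x ∈ S`, `Y > 0`, `m ≥ 2` and `R := Y^d ν`. Then for every finite set `A` of NONZERO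
elements of `S`, `∑_{x ∈ A} ∏_w min(1, (Y|σ_w x|)^{-m}) ≤ 2^{md+3d+1} R^{-(m-1)}`: group the
points by the dyadic sizes `2^{j_w}` of their coordinates; a bucket `j` is empty unless
`2^{|j|} ≥ R` and otherwise holds `≤ 2^{2d+1} 2^{|j|}/R` points (`card_box_le`), each contributing
`≤ 2^{md} 2^{-m|j|}`. [folklore] -/
theorem sum_prod_dec_le {S : Set K} (hS : ∀ x ∈ S, ∀ y ∈ S, x - y ∈ S) {ν : ℝ} (hν : 0 < ν)
    (hnorm : ∀ x ∈ S, x ≠ 0 → ν ≤ |((Algebra.norm ℚ x : ℚ) : ℝ)|)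
    {Y : ℝ} (hY : 0 < Y) {m : ℕ} (hm : 2 ≤ m)
    (A : Finset K) (hAS : ∀ x ∈ A, x ∈ S) (hA0 : ∀ x ∈ A, x ≠ 0) :
    ∑ x ∈ A, ∏ w, dec m (Y * remb K x w) ≤
      2 ^ (m * d + 3 * d + 1) * ((Y ^ d * ν) ^ (m - 1))⁻¹ := by
  set R : ℝ := Y ^ d * ν with hRdef
  have hRpos : 0 < R := by positivity
  have hYd : 0 < Y ^ d := by positivity
  -- bucket vectors
  let J : K → RP → ℕ := fun x w => bucket Y (remb K x w)
  -- (1) termwise bound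
  have hterm : ∀ x, ∏ w, dec m (Y * remb K x w) ≤ 2 ^ (m * d) * ((2 : ℝ) ^ (m * wt (J x)))⁻¹ := by
    intro x
    calc ∏ w, dec m (Y * remb K x w) ≤ ∏ w, (2 : ℝ) ^ m * ((2 : ℝ) ^ (m * J x w))⁻¹ :=
          prod_le_prod (fun w _ => dec_nonneg _ _) fun w _ => dec_mul_le_bucket m hY _
      _ = 2 ^ (m * d) * ((2 : ℝ) ^ (m * wt (J x)))⁻¹ := by
          rw [prod_mul_distrib, prod_const, card_univ, card_RP_eq, ← pow_mul, mul_sum,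
            ← prod_pow_eq_pow_sum, prod_inv_distrib]
  -- (2) fibre bound
  have hfib : ∀ j : RP → ℕ, (((A.filter fun x => J x = j).card : ℝ)) * ((2 : ℝ) ^ (m * wt j))⁻¹ ≤
      2 ^ (2 * d + 1) * (R ^ (m - 1))⁻¹ * ((2 : ℝ) ^ (wt j))⁻¹ := by
    intro j
    set Aj := A.filter fun x => J x = j with hAj
    -- coordinates of points of the fibre
    have hcoord : ∀ x ∈ Aj, ∀ w, |remb K x w| ≤ 2 ^ (j w) / Y := by
      intro x hx w
      rw [mem_filter] at hx
      rw [le_div_iff₀ hY, mul_comm]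
      have := mul_abs_le_two_pow_bucket Y (remb K x w)
      rw [show bucket Y (remb K x w) = j w from congrFun hx.2 w] at this
      exact this
    have hprodT : ∏ w, (2 : ℝ) ^ (j w) / Y = 2 ^ (wt j) / Y ^ d := by
      rw [prod_div_distrib, prod_pow_eq_pow_sum, prod_const, card_univ, card_RP_eq]
    rcases Aj.eq_empty_or_nonempty with hemp | ⟨x₀, hx₀⟩
    · rw [hemp, card_empty, Nat.cast_zero, zero_mul]; positivity
    -- nonempty fibre ⇒ `ν ≤ 2^{|j|}/Y^d`, i.e. `R ≤ 2^{|j|}`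
    have hνT : ν ≤ ∏ w, (2 : ℝ) ^ (j w) / Y := by
      by_contra hlt
      push Not at hlt
      have hx₀A : x₀ ∈ A := (mem_filter.1 hx₀).1
      exact hA0 x₀ hx₀A (eq_zero_of_prod_lt hnorm hlt (hAS x₀ hx₀A) (hcoord x₀ hx₀))
    have hRj : R ≤ 2 ^ (wt j) := by
      rw [hprodT, le_div_iff₀ hYd] at hνT
      rw [hRdef, mul_comm]; exact hνT
    have hcard : (Aj.card : ℝ) ≤ 2 ^ (2 * d + 1) * (∏ w, (2 : ℝ) ^ (j w) / Y) / ν :=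
      card_box_le hS hν hnorm (fun w => by positivity) hνT Aj
        (fun x hx => hAS x (mem_filter.1 hx).1) hcoord
    rw [hprodT] at hcard
    -- `(2^{m|j|})⁻¹ = (2^{|j|})⁻¹ (2^{|j|})^{-(m-2)} (2^{|j|})⁻¹`-type bookkeeping
    obtain ⟨k, hk⟩ : ∃ k, m = k + 2 := ⟨m - 2, by omega⟩
    have h2j : (0 : ℝ) < 2 ^ (wt j) := by positivity
    have hpow : ((2 : ℝ) ^ (m * wt j))⁻¹ = ((2 : ℝ) ^ (wt j))⁻¹ * (((2 : ℝ) ^ (wt j)) ^ k)⁻¹ *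
        ((2 : ℝ) ^ (wt j))⁻¹ := by
      rw [mul_comm m, pow_mul, hk, pow_add, pow_two, mul_inv, mul_inv]
      ring
    have hRk : (((2 : ℝ) ^ (wt j)) ^ k)⁻¹ ≤ (R ^ k)⁻¹ :=
      inv_anti₀ (pow_pos hRpos _) (pow_le_pow_left₀ hRpos.le hRj _)
    have hm1 : m - 1 = k + 1 := by omega
    calc (Aj.card : ℝ) * ((2 : ℝ) ^ (m * wt j))⁻¹
        ≤ 2 ^ (2 * d + 1) * (2 ^ (wt j) / Y ^ d) / ν * (((2 : ℝ) ^ (wt j))⁻¹ *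
            (((2 : ℝ) ^ (wt j)) ^ k)⁻¹ * ((2 : ℝ) ^ (wt j))⁻¹) := by
          rw [← hpow]; exact mul_le_mul_of_nonneg_right hcard (by positivity)
      _ = 2 ^ (2 * d + 1) * R⁻¹ * (((2 : ℝ) ^ (wt j)) ^ k)⁻¹ * ((2 : ℝ) ^ (wt j))⁻¹ := by
          rw [hRdef]; field_simp
      _ ≤ 2 ^ (2 * d + 1) * R⁻¹ * (R ^ k)⁻¹ * ((2 : ℝ) ^ (wt j))⁻¹ := by gcongr
      _ = 2 ^ (2 * d + 1) * (R ^ (m - 1))⁻¹ * ((2 : ℝ) ^ (wt j))⁻¹ := by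
          rw [hm1, pow_succ, mul_inv]; ring
  -- (3) assemble
  have hmaps : ∀ x ∈ A, J x ∈ A.image J := fun x hx => mem_image_of_mem _ hx
  calc ∑ x ∈ A, ∏ w, dec m (Y * remb K x w)
      ≤ ∑ x ∈ A, 2 ^ (m * d) * ((2 : ℝ) ^ (m * wt (J x)))⁻¹ := sum_le_sum fun x _ => hterm x
    _ = 2 ^ (m * d) * ∑ j ∈ A.image J, ∑ x ∈ A.filter (fun x => J x = j),
          ((2 : ℝ) ^ (m * wt (J x)))⁻¹ := by
        rw [← mul_sum, sum_fiberwise_of_maps_to hmaps]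
    _ = 2 ^ (m * d) * ∑ j ∈ A.image J, ((A.filter fun x => J x = j).card : ℝ) *
          ((2 : ℝ) ^ (m * wt j))⁻¹ := by
        congr 1
        refine sum_congr rfl fun j _ => ?_
        rw [sum_congr rfl fun x hx => by rw [(mem_filter.1 hx).2], sum_const, nsmul_eq_mul]
    _ ≤ 2 ^ (m * d) * ∑ j ∈ A.image J, 2 ^ (2 * d + 1) * (R ^ (m - 1))⁻¹ * ((2 : ℝ) ^ (wt j))⁻¹ :=
        mul_le_mul_of_nonneg_left (sum_le_sum fun j _ => hfib j) (by positivity)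
    _ = 2 ^ (m * d) * (2 ^ (2 * d + 1) * (R ^ (m - 1))⁻¹) * ∑ j ∈ A.image J, ((2 : ℝ) ^ (wt j))⁻¹ := by
        rw [← mul_sum]; ring
    _ ≤ 2 ^ (m * d) * (2 ^ (2 * d + 1) * (R ^ (m - 1))⁻¹) * 2 ^ d := by
        gcongr
        exact sum_inv_two_pow_wt_le _
    _ = 2 ^ (m * d + 3 * d + 1) * (R ^ (m - 1))⁻¹ := by
        rw [show m * d + 3 * d + 1 = m * d + (2 * d + 1) + d by ring, pow_add, pow_add]; ring

end Boxes

/-! ## Fourier transforms of product weights on the Minkowski space of a totally real field -/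

section Fourier

variable (K : Type*) [Field K] [NumberField K] [IsTotallyReal K]

local notation "RP" => {w : InfinitePlace K // IsReal w}
local notation "V" => euclidean.mixedSpace K

/-- A totally real field has no complex places. [folklore] -/
instance isEmpty_complexPlaces : IsEmpty {w : InfinitePlace K // IsComplex w} :=
  ⟨fun w => (not_isReal_iff_isComplex.2 w.2) (IsTotallyReal.isReal w.1)⟩

/-- The product weight `F(x) = ∏_w g_w(x_w)` on `ℝ^{RP}`. [folklore] -/
def prodWeight (g : RP → ℝ → ℂ) (x : RP → ℝ) : ℂ := ∏ w, g w (x w)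

/-- The product weight as a function on the euclidean Minkowski space `V ≅ ℝ^{RP}` (totally real
`K`: the complex factor of `K_ℝ` is trivial). [folklore] -/
def testFn (g : RP → ℝ → ℂ) (v : V) : ℂ := prodWeight K g fun w => (euclidean.toMixed K v).1 w

variable {K}

/-- The inner product of `V` in real coordinates (totally real case of the tree's
`inner_toMixed_symm`). [folklore] -/
theorem inner_eq_sum (v ξ : V) :
    inner ℝ v ξ = ∑ w : RP, (euclidean.toMixed K v).1 w * (euclidean.toMixed K ξ).1 w := by
  have h := inner_toMixed_symm (K := K) (euclidean.toMixed K v) (euclidean.toMixed K ξ)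
  simp only [ContinuousLinearEquiv.symm_apply_apply] at h
  rw [h, Finset.univ_eq_empty (α := {w : InfinitePlace K // IsComplex w}), Finset.sum_empty,
    add_zero]

/-- The complex factor of `K_ℝ` carries a probability measure (it is a point). [folklore] -/
theorem volume_complexPart_real_univ :
    (volume : Measure ({w : InfinitePlace K // IsComplex w} → ℂ)).real Set.univ = 1 := by
  have : (volume : Measure ({w : InfinitePlace K // IsComplex w} → ℂ)) =
      Measure.dirac (fun w => isEmptyElim w) := Measure.pi_of_empty _
  rw [this, Measure.real, Measure.dirac_apply_of_mem (Set.mem_univ _), ENNReal.toReal_one]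

omit [IsTotallyReal K] in
/-- `𝐞(-∑_w a_w) = ∏_w 𝐞(-a_w)` in `ℂ`. [folklore] -/
theorem coe_fourierChar_neg_sum (a : RP → ℝ) :
    ((𝐞 (-∑ w, a w) : Circle) : ℂ) = ∏ w, ((𝐞 (-a w) : Circle) : ℂ) := by
  simp only [Real.fourierChar_apply]
  rw [← Complex.exp_sum]
  congr 1
  push_cast
  rw [← Finset.sum_mul, mul_neg, Finset.mul_sum, ← Finset.sum_neg_distrib]
  simp only [mul_neg]

/-- **Fourier transform of a product weight**: `𝓕(F ∘ toMixed)(ξ) = ∏_w ĝ_w(ξ_w)` for totally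
real `K` (change of variables along the volume-preserving `toMixed`, the trivial complex factor,
and Fubini over the real coordinates). [folklore] -/
theorem fourier_testFn (g : RP → ℝ → ℂ) (ξ : V) :
    𝓕 (testFn K g) ξ = ∏ w, 𝓕 (g w) ((euclidean.toMixed K ξ).1 w) := by
  set ζ : RP → ℝ := fun w => (euclidean.toMixed K ξ).1 w with hζ
  have hmp := euclidean.volumePreserving_toMixed_symm K
  have hme : MeasurableEmbedding (euclidean.toMixed K).symm :=
    (euclidean.toMixed K).symm.toHomeomorph.measurableEmbedding
  -- the integrand in Minkowski coordinates
  set H : (RP → ℝ) → ℂ := fun x => ∏ w, ((𝐞 (-(x w * ζ w)) : Circle) : ℂ) * g w (x w) with hH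
  have hint : ∀ u : mixedSpace K,
      (𝐞 (-inner ℝ ((euclidean.toMixed K).symm u) ξ) : Circle) •
        testFn K g ((euclidean.toMixed K).symm u) = H u.1 := by
    intro u
    rw [inner_eq_sum, Circle.smul_def, smul_eq_mul, hH]
    simp only [ContinuousLinearEquiv.apply_symm_apply, testFn, prodWeight]
    rw [coe_fourierChar_neg_sum, ← Finset.prod_mul_distrib]
  have hfac : ∀ w, ∫ x : ℝ, ((𝐞 (-(x * ζ w)) : Circle) : ℂ) * g w x = 𝓕 (g w) (ζ w) := by
    intro w
    rw [Real.fourier_real_eq]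
    simp_rw [Circle.smul_def, smul_eq_mul]
  calc 𝓕 (testFn K g) ξ = ∫ v, (𝐞 (-inner ℝ v ξ) : Circle) • testFn K g v := Real.fourier_eq _ _
    _ = ∫ u : mixedSpace K, (𝐞 (-inner ℝ ((euclidean.toMixed K).symm u) ξ) : Circle) •
          testFn K g ((euclidean.toMixed K).symm u) :=
        (hmp.integral_comp hme (fun v => (𝐞 (-inner ℝ v ξ) : Circle) • testFn K g v)).symm
    _ = ∫ u : mixedSpace K, H u.1 := integral_congr_ae (Filter.Eventually.of_forall hint)
    _ = ∫ u : ({w : InfinitePlace K // IsReal w} → ℝ) × ({w : InfinitePlace K // IsComplex w} → ℂ),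
          H u.1 ∂((volume.prod volume)) := by rw [Measure.volume_eq_prod]
    _ = ∫ x : RP → ℝ, H x := by
        rw [integral_fun_fst, volume_complexPart_real_univ, one_smul]
    _ = ∏ w, ∫ x : ℝ, ((𝐞 (-(x * ζ w)) : Circle) : ℂ) * g w x := by
        rw [hH]
        exact integral_fintype_prod_volume_eq_prod (𝕜 := ℂ)
          (fun w (x : ℝ) => ((𝐞 (-(x * ζ w)) : Circle) : ℂ) * g w x)
    _ = ∏ w, 𝓕 (g w) (ζ w) := Finset.prod_congr rfl fun w _ => hfac w

omit [IsTotallyReal K] in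
/-- **Translation only changes the phase**: `|𝓕(F(· + v₀))(ξ)| = |𝓕F(ξ)|` and the value at
`ξ = 0` is unchanged. [folklore] -/
theorem fourier_comp_add_right (f : V → ℂ) (v₀ ξ : V) :
    𝓕 (f ∘ fun v => v + v₀) ξ = ((𝐞 (inner ℝ v₀ ξ) : Circle) : ℂ) * 𝓕 f ξ := by
  have h := VectorFourier.fourierIntegral_comp_add_right 𝐞 volume (innerₗ V) f v₀
  have h1 := congrFun h ξ
  simp only [innerₗ_apply_apply] at h1
  rw [show 𝓕 (f ∘ fun v => v + v₀) = VectorFourier.fourierIntegral 𝐞 volume (innerₗ V)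
      (f ∘ fun v => v + v₀) from rfl, h1, Circle.smul_def, smul_eq_mul]
  rfl

omit [IsTotallyReal K] in
/-- `|𝓕(f(· + v₀))(ξ)| = |𝓕f(ξ)|`. [folklore] -/
theorem norm_fourier_comp_add_right (f : V → ℂ) (v₀ ξ : V) :
    ‖𝓕 (f ∘ fun v => v + v₀) ξ‖ = ‖𝓕 f ξ‖ := by
  rw [fourier_comp_add_right, norm_mul, Circle.norm_coe, one_mul]

omit [IsTotallyReal K] in
/-- `𝓕(f(· + v₀))(0) = 𝓕f(0)`. [folklore] -/
theorem fourier_comp_add_right_zero (f : V → ℂ) (v₀ : V) :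
    𝓕 (f ∘ fun v => v + v₀) 0 = 𝓕 f 0 := by
  rw [fourier_comp_add_right, inner_zero_right, AddChar.map_zero_eq_one, Circle.coe_one, one_mul]

end Fourier

/-! ## Poisson summation for smooth coset sums -/

section Poisson

variable {K : Type*} [Field K] [NumberField K] [IsTotallyReal K]

local notation "d" => Module.finrank ℚ K
local notation "RP" => {w : InfinitePlace K // IsReal w}
local notation "V" => euclidean.mixedSpace K

/-- **Compactly supported continuous functions decay faster than any power.** [folklore] -/
theorem exists_decay_of_hasCompactSupport {E : Type*} [NormedAddCommGroup E] [NormedSpace ℝ E]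
    [ProperSpace E] {f : E → ℂ} (hf : Continuous f) (hs : HasCompactSupport f) {b : ℝ}
    (hb : 0 ≤ b) : ∃ C : ℝ, ∀ x, ‖f x‖ ≤ C * (1 + ‖x‖) ^ (-b) := by
  obtain ⟨B, hB⟩ := hf.bounded_above_of_compact_support hs
  obtain ⟨ρ, hρ⟩ := hs.isCompact.isBounded.subset_closedBall 0
  have hB0 : 0 ≤ B := (norm_nonneg _).trans (hB 0)
  refine ⟨B * (1 + max ρ 0) ^ b, fun x => ?_⟩
  by_cases hx : f x = 0
  · rw [hx, norm_zero]; positivity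
  · have hxs : x ∈ Metric.closedBall (0 : E) ρ := hρ (subset_tsupport _ (Function.mem_support.2 hx))
    rw [Metric.mem_closedBall, dist_zero_right] at hxs
    have h1 : (1 + ‖x‖) ^ (-b) ≥ (1 + max ρ 0) ^ (-b) := by
      apply Real.rpow_le_rpow_of_nonpos (by positivity) _ (by linarith)
      linarith [le_max_left ρ 0]
    calc ‖f x‖ ≤ B := hB x
      _ = B * (1 + max ρ 0) ^ b * (1 + max ρ 0) ^ (-b) := by
          rw [mul_assoc, ← Real.rpow_add (by positivity), add_neg_cancel, Real.rpow_zero, mul_one]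
      _ ≤ B * (1 + max ρ 0) ^ b * (1 + ‖x‖) ^ (-b) := by gcongr

omit [IsTotallyReal K] in
/-- The product weight is continuous. [folklore] -/
theorem continuous_prodWeight {g : RP → ℝ → ℂ} (hgc : ∀ w, Continuous (g w)) :
    Continuous (prodWeight K g) :=
  continuous_finsetProd _ fun w _ => (hgc w).comp (continuous_apply w)

omit [IsTotallyReal K] in
/-- The product weight has compact support. [folklore] -/
theorem hasCompactSupport_prodWeight {g : RP → ℝ → ℂ} (hgs : ∀ w, HasCompactSupport (g w)) :
    HasCompactSupport (prodWeight K g) := by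
  refine HasCompactSupport.intro (isCompact_univ_pi fun w => (hgs w).isCompact) fun x hx => ?_
  simp only [Set.mem_univ_pi, not_forall] at hx
  obtain ⟨w, hw⟩ := hx
  exact Finset.prod_eq_zero (Finset.mem_univ w) (image_eq_zero_of_notMem_tsupport hw)

omit [IsTotallyReal K] in
/-- The test function is continuous. [folklore] -/
theorem continuous_testFn {g : RP → ℝ → ℂ} (hgc : ∀ w, Continuous (g w)) :
    Continuous (testFn K g) :=
  (continuous_prodWeight hgc).comp (continuous_fst.comp (euclidean.toMixed K).continuous)

/-- The test function has compact support (the complex factor of `K_ℝ` is a point). [folklore] -/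
theorem hasCompactSupport_testFn {g : RP → ℝ → ℂ} (hgs : ∀ w, HasCompactSupport (g w)) :
    HasCompactSupport (testFn K g) := by
  set K₀ := tsupport (prodWeight K g) with hK₀
  have hK₀c : IsCompact K₀ := (hasCompactSupport_prodWeight hgs).isCompact
  have hKc : IsCompact ((euclidean.toMixed K) ⁻¹' (K₀ ×ˢ (Set.univ :
      Set ({w : InfinitePlace K // IsComplex w} → ℂ)))) := by
    rw [← ContinuousLinearEquiv.image_symm_eq_preimage]
    exact (hK₀c.prod isCompact_univ).image (euclidean.toMixed K).symm.continuous
  refine HasCompactSupport.intro hKc fun v hv => ?_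
  simp only [Set.mem_preimage, Set.mem_prod, Set.mem_univ, and_true] at hv
  exact image_eq_zero_of_notMem_tsupport (f := prodWeight K g) hv

omit [IsTotallyReal K] in
/-- Translates of compactly supported functions are compactly supported. [folklore] -/
theorem hasCompactSupport_comp_add_right {f : V → ℂ} (hf : HasCompactSupport f) (v₀ : V) :
    HasCompactSupport (f ∘ fun v => v + v₀) := by
  refine HasCompactSupport.intro ((Homeomorph.addRight v₀).isCompact_preimage.2 hf.isCompact)
    fun v hv => ?_
  exact image_eq_zero_of_notMem_tsupport (f := f) hv

/-- The elements of an integral ideal and of its fractional-ideal coercion correspond. [folklore] -/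
def idealEquivCoe (𝔞 : Ideal (𝓞 K)) :
    𝔞 ≃ ((𝔞 : FractionalIdeal (𝓞 K)⁰ K) : Set K) where
  toFun a := ⟨algebraMap (𝓞 K) K (a : 𝓞 K), FractionalIdeal.mem_coeIdeal_of_mem _ a.2⟩
  invFun x := ⟨⟨x.1, by
      obtain ⟨a, _, ha⟩ := (FractionalIdeal.mem_coeIdeal _).1 x.2
      rw [← ha]; exact (a : 𝓞 K).2⟩, by
      obtain ⟨a, ha, hax⟩ := (FractionalIdeal.mem_coeIdeal _).1 x.2
      convert ha
      ext
      exact hax.symm⟩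
  left_inv a := by ext; rfl
  right_inv x := by rfl

omit [NumberField K] [IsTotallyReal K] in
/-- `idealEquivCoe` is the identity on underlying elements. [folklore] -/
@[simp] theorem coe_idealEquivCoe (𝔞 : Ideal (𝓞 K)) (a : 𝔞) :
    ((idealEquivCoe 𝔞 a : ((𝔞 : FractionalIdeal (𝓞 K)⁰ K) : Set K)) : K) = ((a : 𝓞 K) : K) := rfl

variable (K) in
/-- The elements of the dual `(𝔞𝔡)⁻¹ = 𝔞^∨` of an integral ideal, as an additive group. [folklore] -/
abbrev DualElts (𝔞 : Ideal (𝓞 K)) : Type _ :=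
  ((FractionalIdeal.dual ℤ ℚ (𝔞 : FractionalIdeal (𝓞 K)⁰ K) : FractionalIdeal (𝓞 K)⁰ K) :
    Submodule (𝓞 K) K)

omit [IsTotallyReal K] in
/-- **Nonzero elements of `(𝔞𝔡)⁻¹` have norm `≥ (N𝔞 N𝔡)⁻¹`.** [folklore] -/
theorem inv_le_abs_norm_of_mem_dual {𝔞 : Ideal (𝓞 K)} (h𝔞 : 𝔞 ≠ ⊥) {x : K}
    (hx : x ∈ (FractionalIdeal.dual ℤ ℚ (𝔞 : FractionalIdeal (𝓞 K)⁰ K) : FractionalIdeal (𝓞 K)⁰ K))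
    (hx0 : x ≠ 0) :
    ((Ideal.absNorm 𝔞 : ℝ) * Ideal.absNorm (differentIdeal ℤ (𝓞 K)))⁻¹ ≤
      |((Algebra.norm ℚ x : ℚ) : ℝ)| := by
  have h𝔡 : differentIdeal ℤ (𝓞 K) ≠ ⊥ := by
    intro h
    have h1 := one_le_absNorm_differentIdeal (K := K)
    rw [h, Ideal.absNorm_bot, Nat.cast_zero] at h1
    norm_num at h1
  have hJ : 𝔞 * differentIdeal ℤ (𝓞 K) ≠ ⊥ := by
    rw [Ne, Ideal.mul_eq_bot, not_or]; exact ⟨h𝔞, h𝔡⟩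
  rw [dual_coeIdeal_eq_inv] at hx
  have h := inv_absNorm_le_abs_norm_of_mem_inv hJ hx hx0
  rw [map_mul, Nat.cast_mul] at h
  have h2 : ((((Ideal.absNorm 𝔞 : ℚ) * (Ideal.absNorm (differentIdeal ℤ (𝓞 K)) : ℚ))⁻¹ : ℚ) : ℝ) ≤
      ((|Algebra.norm ℚ x| : ℚ) : ℝ) := by exact_mod_cast h
  push_cast at h2
  exact h2

omit [IsTotallyReal K] in
/-- `N𝔞 > 0` as a real number for `𝔞 ≠ 0`. [folklore] -/
theorem absNorm_cast_pos {𝔞 : Ideal (𝓞 K)} (h𝔞 : 𝔞 ≠ ⊥) : (0 : ℝ) < Ideal.absNorm 𝔞 := by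
  have : Ideal.absNorm 𝔞 ≠ 0 := by rwa [Ne, Ideal.absNorm_eq_zero_iff]
  positivity

/-- **Smooth sums over a coset of an ideal** (Poisson summation + the dual-lattice estimate).
Let `K` be totally real of degree `d`, `g_w ∈ C_c(ℝ)` (one function per real place) with
`|ĝ_w(τ)| ≤ G min(1,|τ|^{-m})` (`m ≥ 2`; e.g. `g_w ∈ C^m_c`, `norm_fourier_le_dec`), `𝔞 ≠ 0` an
ideal, `Y > 0`, `β ∈ 𝓞_K`. Then

  `|∑_{a ∈ 𝔞} ∏_w g_w(σ_w(a+β)/Y) − (∏_w ∫g_w) · Y^d/(N𝔞 √|d_K|)|`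
  `   ≤ 2^{md+3d+1} G^d · (Y^d/(N𝔞√|d_K|)) · (N𝔞 N𝔡 / Y^d)^{m-1}`,

uniformly in `β` (Neukirch VII (3.2) on the lattice `Y⁻¹ j(𝔞) ⊂ ℝ^d`, whose covolume is
`N𝔞 √|d_K|/Y^d` and whose dual is `Y j((𝔞𝔡)⁻¹)`; the `ξ = 0` term is the main term, the
translation by `β` only introduces phases, and the remaining dual sum is `sum_prod_dec_le` with
`ν = (N𝔞N𝔡)⁻¹`). [cite: NeukirchANT1999, Ch. VII (3.2), (5.7)] -/
theorem coset_sum {m : ℕ} (hm : 2 ≤ m) {g : RP → ℝ → ℂ} (hgc : ∀ w, Continuous (g w))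
    (hgs : ∀ w, HasCompactSupport (g w)) {G : ℝ} (hG : ∀ w τ, ‖𝓕 (g w) τ‖ ≤ G * dec m τ)
    {𝔞 : Ideal (𝓞 K)} (h𝔞 : 𝔞 ≠ ⊥) {Y : ℝ} (hY : 0 < Y) (β : 𝓞 K) :
    ‖(∑' a : 𝔞, prodWeight K g fun w => remb K (((a : 𝓞 K) : K) + β) w / Y) -
        (∏ w, ∫ x, g w x) * ↑(Y ^ d / (Ideal.absNorm 𝔞 * Real.sqrt |(discr K : ℝ)|))‖ ≤
      2 ^ (m * d + 3 * d + 1) * G ^ d * (Y ^ d / (Ideal.absNorm 𝔞 * Real.sqrt |(discr K : ℝ)|)) *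
        ((Ideal.absNorm 𝔞 : ℝ) * Ideal.absNorm (differentIdeal ℤ (𝓞 K)) / Y ^ d) ^ (m - 1) := by
  have hd : 0 < d := Module.finrank_pos
  -- `G ≥ 0`
  have hG0 : 0 ≤ G := by
    obtain ⟨w₀⟩ := (inferInstance : Nonempty RP)
    have h := hG w₀ 0
    rw [dec_of_abs_le_one (by simp), mul_one] at h
    exact (norm_nonneg _).trans h
  have hN𝔞 := absNorm_cast_pos h𝔞
  have hN𝔡 : (0 : ℝ) < Ideal.absNorm (differentIdeal ℤ (𝓞 K)) :=
    lt_of_lt_of_le one_pos one_le_absNorm_differentIdeal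
  have hD : 0 < Real.sqrt |(discr K : ℝ)| :=
    Real.sqrt_pos.2 (abs_pos.2 (Int.cast_ne_zero.2 (discr_ne_zero K)))
  -- the lattice `Λ = Y⁻¹ j(𝔞)` in the euclidean Minkowski space
  have h𝔞0 : ((𝔞 : FractionalIdeal (𝓞 K)⁰ K)) ≠ 0 := FractionalIdeal.coeIdeal_ne_zero.2 h𝔞
  set I : (FractionalIdeal (𝓞 K)⁰ K)ˣ := Units.mk0 _ h𝔞0 with hI
  set c : InfinitePlace K → ℝ := fun _ => Y⁻¹ with hc
  have hc0 : ∀ w, c w ≠ 0 := fun _ => inv_ne_zero hY.ne'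
  set Λ := scaledIdealLattice c hc0 I with hΛ
  set vβ : V := (euclidean.toMixed K).symm (scaleMixed K c (mixedEmbedding K (β : K))) with hvβ
  set f : V → ℂ := testFn K g ∘ fun v => v + vβ with hf
  -- continuity and decay of `f`
  have hfc : Continuous f := (continuous_testFn hgc).comp (continuous_id.add continuous_const)
  have hfs : HasCompactSupport f :=
    hasCompactSupport_comp_add_right (hasCompactSupport_testFn hgs) vβ
  have hb : (Module.finrank ℝ V : ℝ) < (Module.finrank ℝ V : ℝ) + 1 := by linarith
  obtain ⟨C, hC⟩ := exists_decay_of_hasCompactSupport hfc hfs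
    (b := (Module.finrank ℝ V : ℝ) + 1) (by positivity)
  -- the dual lattice through `(𝔞𝔡)⁻¹`
  set e' : DualElts K 𝔞 ≃ Literature.Algebra.EuclideanLattices.dualLattice Λ :=
    dualIdealEquivDualLattice c hc0 I with he'
  have hcoord' : ∀ (a' : DualElts K 𝔞) (w : RP),
      (euclidean.toMixed K (e' a' : V)).1 w = Y * remb K (a' : K) w := by
    intro a' w
    have h1 : (e' a' : V) = (euclidean.toMixed K).symm
        (scaleMixed K c⁻¹ (twistMixed (mixedEmbedding K (a' : K)))) :=
      coe_dualIdealEquivDualLattice_apply c hc0 I a'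
    rw [h1, ContinuousLinearEquiv.apply_symm_apply, scaleMixed_apply_fst, twistMixed_fst,
      mixedEmbedding_apply_isReal]
    simp [hc, remb]
  have hFnorm : ∀ a' : DualElts K 𝔞,
      ‖𝓕 f (e' a' : V)‖ ≤ G ^ d * ∏ w, dec m (Y * remb K (a' : K) w) := by
    intro a'
    rw [hf, norm_fourier_comp_add_right, fourier_testFn, norm_prod]
    simp_rw [hcoord']
    calc ∏ w, ‖𝓕 (g w) (Y * remb K (a' : K) w)‖ ≤ ∏ w, G * dec m (Y * remb K (a' : K) w) :=
          prod_le_prod (fun w _ => norm_nonneg _) fun w _ => hG w _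
      _ = G ^ d * ∏ w, dec m (Y * remb K (a' : K) w) := by
          rw [prod_mul_distrib, prod_const, card_univ, card_RP_eq]
  -- the dual-lattice estimate
  set ν : ℝ := ((Ideal.absNorm 𝔞 : ℝ) * Ideal.absNorm (differentIdeal ℤ (𝓞 K)))⁻¹ with hν
  have hνpos : 0 < ν := by positivity
  set Sd : Set K := ((FractionalIdeal.dual ℤ ℚ (𝔞 : FractionalIdeal (𝓞 K)⁰ K) :
      FractionalIdeal (𝓞 K)⁰ K) : Set K) with hSd
  have hSsub : ∀ x ∈ Sd, ∀ y ∈ Sd, x - y ∈ Sd := fun x hx y hy => Submodule.sub_mem _ hx hy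
  have hSnorm : ∀ x ∈ Sd, x ≠ 0 → ν ≤ |((Algebra.norm ℚ x : ℚ) : ℝ)| :=
    fun x hx hx0 => inv_le_abs_norm_of_mem_dual h𝔞 hx hx0
  set B : ℝ := 2 ^ (m * d + 3 * d + 1) * ((Y ^ d * ν) ^ (m - 1))⁻¹ with hB
  have hB0 : 0 ≤ B := by positivity
  -- majorant on the dual side
  set M : DualElts K 𝔞 → ℝ :=
    fun a' => if a' = 0 then ‖𝓕 f (e' 0 : V)‖ else G ^ d * ∏ w, dec m (Y * remb K (a' : K) w)
    with hM
  have hM0 : ∀ a', 0 ≤ M a' := by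
    intro a'; simp only [hM]; split_ifs
    · exact norm_nonneg _
    · exact mul_nonneg (pow_nonneg hG0 _) (prod_nonneg fun w _ => dec_nonneg _ _)
  have hFleM : ∀ a', ‖𝓕 f (e' a' : V)‖ ≤ M a' := by
    intro a'; simp only [hM]; split_ifs with h
    · rw [h]
    · exact hFnorm a'
  -- partial sums of the nonzero part
  have hpartial : ∀ s : Finset (DualElts K 𝔞),
      ∑ a' ∈ s, (if a' = 0 then 0 else G ^ d * ∏ w, dec m (Y * remb K (a' : K) w)) ≤ G ^ d * B := by
    intro s
    set A : Finset K := Finset.image (fun a' : DualElts K 𝔞 => ((a' : K) : K))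
      (s.filter fun a' => a' ≠ 0) with hA
    have hAS : ∀ x ∈ A, x ∈ Sd := by
      intro x hx
      obtain ⟨a', _, rfl⟩ := mem_image.1 hx
      exact a'.2
    have hA0 : ∀ x ∈ A, x ≠ 0 := by
      intro x hx
      obtain ⟨a', ha', rfl⟩ := mem_image.1 hx
      have h := (mem_filter.1 ha').2
      exact fun h0 => h (Subtype.ext h0)
    have hinj : Set.InjOn (fun a' : DualElts K 𝔞 => ((a' : K) : K)) (s.filter fun a' => a' ≠ 0) :=
      fun _ _ _ _ h => Subtype.ext h
    have key := sum_prod_dec_le hSsub hνpos hSnorm hY hm A hAS hA0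
    rw [hA, sum_image hinj] at key
    calc ∑ a' ∈ s, (if a' = 0 then 0 else G ^ d * ∏ w, dec m (Y * remb K (a' : K) w))
        = ∑ a' ∈ s.filter (fun a' => a' ≠ 0), G ^ d * ∏ w, dec m (Y * remb K (a' : K) w) := by
          rw [sum_filter]
          refine sum_congr rfl fun a' _ => ?_
          by_cases h : a' = 0 <;> simp [h]
      _ = G ^ d * ∑ a' ∈ s.filter (fun a' => a' ≠ 0), ∏ w, dec m (Y * remb K (a' : K) w) := by
          rw [mul_sum]
      _ ≤ G ^ d * B := mul_le_mul_of_nonneg_left key (pow_nonneg hG0 _)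
  have hMsum : Summable M := by
    refine summable_of_sum_le hM0 (c := ‖𝓕 f (e' 0 : V)‖ + G ^ d * B) fun s => ?_
    have hsplit : ∀ a', M a' = (if a' = 0 then ‖𝓕 f (e' 0 : V)‖ else 0) +
        (if a' = 0 then 0 else G ^ d * ∏ w, dec m (Y * remb K (a' : K) w)) := by
      intro a'; simp only [hM]; split_ifs <;> simp
    simp_rw [hsplit]
    rw [sum_add_distrib]
    gcongr
    · rw [sum_ite_eq']
      split_ifs
      · exact le_rfl
      · exact norm_nonneg _
    · exact hpartial s
  have hFsum' : Summable fun a' => 𝓕 f (e' a' : V) := Summable.of_norm_bounded hMsum hFleM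
  have hFsum : Summable fun ξ : Literature.Algebra.EuclideanLattices.dualLattice Λ => 𝓕 f ξ :=
    e'.summable_iff.1 hFsum'
  -- Poisson summation
  have hP := Literature.NumberTheory.LFunctions.Fourier.tsum_eq_tsum_fourier_of_rpow_decay Λ hfc hb hC hFsum
  -- the left-hand side
  set e : 𝔞 ≃ Λ := (idealEquivCoe 𝔞).trans
    (idealEquivScaledIdealLattice c hc0 I : ((𝔞 : FractionalIdeal (𝓞 K)⁰ K) : Set K) ≃ Λ) with he
  have hLHS : ∑' x : Λ, f x = ∑' a : 𝔞, prodWeight K g fun w => remb K (((a : 𝓞 K) : K) + β) w / Y := by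
    rw [← e.tsum_eq]
    refine tsum_congr fun a => ?_
    have hea : (e a : V) = (euclidean.toMixed K).symm (scaleMixed K c (mixedEmbedding K ((a : 𝓞 K) : K))) :=
      coe_idealEquivScaledIdealLattice_apply c hc0 I (idealEquivCoe 𝔞 a)
    show testFn K g ((e a : V) + vβ) = _
    rw [hea, hvβ, ← map_add, ← map_add, ← map_add]
    simp only [testFn, ContinuousLinearEquiv.apply_symm_apply, scaleMixed_apply_fst,
      mixedEmbedding_apply_isReal, hc]
    congr 1
    funext w
    simp [remb, div_eq_inv_mul]
  -- the main term
  have hprodc : ∏ w : InfinitePlace K, c w ^ mult w = Y⁻¹ ^ d := by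
    simp only [hc]
    rw [prod_pow_eq_pow_sum, sum_mult_eq]
  have hcov : ZLattice.covolume Λ = (Ideal.absNorm 𝔞 * Real.sqrt |(discr K : ℝ)|) / Y ^ d := by
    rw [hΛ, covolume_scaledIdealLattice, covolume_idealLattice,
      IsTotallyReal.nrComplexPlaces_eq_zero, pow_zero, mul_one, hprodc,
      abs_of_pos (by positivity), hI, Units.val_mk0, FractionalIdeal.coeIdeal_absNorm,
      Rat.cast_natCast, inv_pow, div_eq_inv_mul]
  have hF0 : 𝓕 f 0 = ∏ w, ∫ x, g w x := by
    rw [hf, fourier_comp_add_right_zero, fourier_testFn]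
    refine prod_congr rfl fun w _ => ?_
    rw [map_zero, Prod.fst_zero, Pi.zero_apply, Real.fourier_real_eq]
    simp
  -- the right-hand side: split off `ξ = 0`
  have he'0 : (e' 0 : V) = 0 := by
    have h1 : (e' 0 : V) = (euclidean.toMixed K).symm
        (scaleMixed K c⁻¹ (twistMixed (mixedEmbedding K ((0 : DualElts K 𝔞) : K)))) :=
      coe_dualIdealEquivDualLattice_apply c hc0 I (0 : DualElts K 𝔞)
    rw [h1, ZeroMemClass.coe_zero, map_zero]
    have : twistMixed (0 : mixedSpace K) = 0 := by
      ext <;> simp [twistMixed]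
    rw [this, map_zero, map_zero]
  have hRHS : ∑' ξ : Literature.Algebra.EuclideanLattices.dualLattice Λ, 𝓕 f ξ =
      𝓕 f 0 + ∑' a', (if a' = 0 then 0 else 𝓕 f (e' a' : V)) := by
    rw [← e'.tsum_eq, hFsum'.tsum_eq_add_tsum_ite 0, he'0]
  have hErr : ‖∑' a', (if a' = 0 then 0 else 𝓕 f (e' a' : V))‖ ≤ G ^ d * B := by
    have hle : ∀ a' : DualElts K 𝔞, ‖(if a' = 0 then 0 else 𝓕 f (e' a' : V))‖ ≤
        (if a' = 0 then 0 else G ^ d * ∏ w, dec m (Y * remb K (a' : K) w)) := by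
      intro a'; split_ifs
      · simp
      · exact hFnorm a'
    have hs2 : Summable fun a' : DualElts K 𝔞 =>
        (if a' = 0 then (0 : ℝ) else G ^ d * ∏ w, dec m (Y * remb K (a' : K) w)) :=
      summable_of_sum_le (fun a' => by
        simp only [Pi.zero_apply]
        split_ifs
        · exact le_rfl
        · exact mul_nonneg (pow_nonneg hG0 _) (prod_nonneg fun w _ => dec_nonneg _ _)) hpartial
    have hs1 : Summable fun a' : DualElts K 𝔞 => ‖(if a' = 0 then 0 else 𝓕 f (e' a' : V))‖ :=
      hs2.of_nonneg_of_le (fun _ => norm_nonneg _) hle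
    calc ‖∑' a' : DualElts K 𝔞, (if a' = 0 then 0 else 𝓕 f (e' a' : V))‖
        ≤ ∑' a' : DualElts K 𝔞, ‖(if a' = 0 then 0 else 𝓕 f (e' a' : V))‖ :=
          norm_tsum_le_tsum_norm hs1
      _ ≤ ∑' a' : DualElts K 𝔞,
            (if a' = 0 then (0 : ℝ) else G ^ d * ∏ w, dec m (Y * remb K (a' : K) w)) :=
          hs1.tsum_le_tsum hle hs2
      _ ≤ G ^ d * B := hs2.tsum_le_of_sum_le hpartial
  -- assemble
  rw [← hLHS, hP, hRHS, smul_add, hF0, hcov]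
  have hmain : ((Ideal.absNorm 𝔞 * Real.sqrt |(discr K : ℝ)|) / Y ^ d)⁻¹ • (∏ w, ∫ x, g w x) -
      (∏ w, ∫ x, g w x) * ↑(Y ^ d / (Ideal.absNorm 𝔞 * Real.sqrt |(discr K : ℝ)|)) = 0 := by
    rw [Complex.real_smul, inv_div, mul_comm, sub_self]
  rw [add_sub_right_comm, hmain, zero_add, Complex.real_smul, norm_mul, Complex.norm_real,
    Real.norm_eq_abs, inv_div, abs_of_pos (by positivity)]
  calc Y ^ d / (Ideal.absNorm 𝔞 * Real.sqrt |(discr K : ℝ)|) *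
        ‖∑' a', (if a' = 0 then 0 else 𝓕 f (e' a' : V))‖
      ≤ Y ^ d / (Ideal.absNorm 𝔞 * Real.sqrt |(discr K : ℝ)|) * (G ^ d * B) := by gcongr
    _ = _ := by
        rw [hB, hν, ← inv_pow, mul_inv, inv_inv]
        ring

end Poisson

/-! ## Type I: twisted smooth sums over an ideal -/

section TypeOne

variable {K : Type*} [Field K] [NumberField K] [IsTotallyReal K]

local notation "d" => Module.finrank ℚ K
local notation "RP" => {w : InfinitePlace K // IsReal w}

open Literature.NumberTheory.Sieve.BoxPrimes

omit [NumberField K] [IsTotallyReal K] in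
/-- A finitely supported sum over an ideal is a finite sum. [folklore] -/
theorem tsum_ideal_eq_sum {𝔞 : Ideal (𝓞 K)} {F : 𝓞 K → ℂ} (A : Finset (𝓞 K))
    (hA : ∀ a : 𝓞 K, a ∈ 𝔞 → F a ≠ 0 → a ∈ A) :
    ∑' a : 𝔞, F a = ∑ a ∈ A.filter (· ∈ 𝔞), F a := by
  rw [tsum_eq_sum (s := (A.filter (· ∈ 𝔞)).subtype (· ∈ 𝔞)) (fun b hb => ?_),
    Finset.sum_subtype_eq_sum_filter]
  · exact Finset.sum_congr (by ext a; simp) fun _ _ => rfl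
  · by_contra h
    exact hb (Finset.mem_subtype.2 (Finset.mem_filter.2 ⟨hA b b.2 h, b.2⟩))

omit [NumberField K] [IsTotallyReal K] in
/-- For coprime `𝔟, 𝔣` every class mod `𝔣` has a representative in `𝔟`. [folklore] -/
theorem exists_mem_ideal_mk_eq {𝔟 𝔣 : Ideal (𝓞 K)} (hcop : IsCoprime 𝔟 𝔣) (q : 𝓞 K ⧸ 𝔣) :
    ∃ b ∈ 𝔟, Ideal.Quotient.mk 𝔣 b = q := by
  obtain ⟨x, rfl⟩ := Ideal.Quotient.mk_surjective q
  obtain ⟨i, hi, j, hj, hij⟩ := Ideal.isCoprime_iff_exists.1 hcop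
  refine ⟨x * i, 𝔟.mul_mem_left x hi, ?_⟩
  rw [Ideal.Quotient.eq]
  have : x * i - x = -(x * j) := by linear_combination x * hij
  rw [this]
  exact 𝔣.neg_mem (𝔣.mul_mem_left x hj)

omit [NumberField K] [IsTotallyReal K] in
/-- `∑_{q mod 𝔣} χ(q) = 0` for a nontrivial character `χ` of `(𝓞_K/𝔣)ˣ` (extended by zero).
[folklore] -/
theorem sum_unitValue_eq_zero {𝔣 : Ideal (𝓞 K)} [Fintype (𝓞 K ⧸ 𝔣)]
    {χ : AddChar (Additive ((𝓞 K ⧸ 𝔣)ˣ)) ℂ} (hχ : χ ≠ 0) :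
    ∑ q : 𝓞 K ⧸ 𝔣, unitValue χ q = 0 := by
  have h := sum_unitValue_mul χ fun _ => 1
  simp only [mul_one] at h
  rw [h]
  have h2 : ∑ u : (𝓞 K ⧸ 𝔣)ˣ, χ (Additive.ofMul u) = ∑ a : Additive ((𝓞 K ⧸ 𝔣)ˣ), χ a :=
    Fintype.sum_equiv Additive.ofMul _ _ fun _ => rfl
  rw [h2, AddChar.sum_eq_zero_iff_ne_zero]
  exact hχ

/-- **Type I estimate** (smooth character sums over an ideal `𝔟`, character mod `𝔣`, `(𝔟,𝔣)=1`):
for `χ ≠ χ₀` mod `𝔣`,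

  `|∑_{a ∈ 𝔟} χ(a) ∏_w g_w(σ_w a / Y)| ≤ N𝔣 · 2^{md+3d+1} G^d (Y^d/(N(𝔟𝔣)√|d_K|)) (N(𝔟𝔣) N𝔡/Y^d)^{m-1}`:

split `a` by its class mod `𝔣` (the classes of `𝔟` mod `𝔟𝔣 = 𝔟 ∩ 𝔣` are ALL the classes mod `𝔣`
since `𝔟 + 𝔣 = 1`); each class sum is the common main term plus an error bounded by `coset_sum`
for the ideal `𝔟𝔣`, and the main terms cancel because `∑_q χ(q) = 0`. This replaces the
Pólya–Vinogradov bound [9] in Hinz's treatment of `S₂, S₃`. [cite: Hinz1988, §4 (4.6)–(4.8)] -/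
theorem charSum_ideal_le {m : ℕ} (hm : 2 ≤ m) {g : RP → ℝ → ℂ} (hgc : ∀ w, Continuous (g w))
    (hgs : ∀ w, HasCompactSupport (g w)) {G : ℝ} (hG : ∀ w τ, ‖𝓕 (g w) τ‖ ≤ G * dec m τ)
    {𝔟 𝔣 : Ideal (𝓞 K)} (h𝔟 : 𝔟 ≠ ⊥) (h𝔣 : 𝔣 ≠ ⊥) (hcop : IsCoprime 𝔟 𝔣) [Fintype (𝓞 K ⧸ 𝔣)]
    {χ : AddChar (Additive ((𝓞 K ⧸ 𝔣)ˣ)) ℂ} (hχ : χ ≠ 0) {Y : ℝ} (hY : 0 < Y) :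
    ‖∑' a : 𝔟, unitValue χ (Ideal.Quotient.mk 𝔣 (a : 𝓞 K)) *
        prodWeight K g fun w => remb K ((a : 𝓞 K) : K) w / Y‖ ≤
      Ideal.absNorm 𝔣 * (2 ^ (m * d + 3 * d + 1) * G ^ d *
        (Y ^ d / (Ideal.absNorm (𝔟 * 𝔣) * Real.sqrt |(discr K : ℝ)|)) *
        ((Ideal.absNorm (𝔟 * 𝔣) : ℝ) * Ideal.absNorm (differentIdeal ℤ (𝓞 K)) / Y ^ d) ^ (m - 1)) := by
  have h𝔟𝔣 : 𝔟 * 𝔣 ≠ ⊥ := by rw [Ne, Ideal.mul_eq_bot, not_or]; exact ⟨h𝔟, h𝔣⟩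
  -- representatives of the classes mod `𝔣` inside `𝔟`
  choose r hr𝔟 hrq using fun q : 𝓞 K ⧸ 𝔣 => exists_mem_ideal_mk_eq hcop q
  -- abbreviations
  set F : 𝓞 K → ℂ := fun a => prodWeight K g fun w => remb K ((a : 𝓞 K) : K) w / Y with hF
  set MT : ℂ := (∏ w, ∫ x, g w x) * ↑(Y ^ d / (Ideal.absNorm (𝔟 * 𝔣) * Real.sqrt |(discr K : ℝ)|))
    with hMT
  set E : ℝ := 2 ^ (m * d + 3 * d + 1) * G ^ d *
      (Y ^ d / (Ideal.absNorm (𝔟 * 𝔣) * Real.sqrt |(discr K : ℝ)|)) *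
      ((Ideal.absNorm (𝔟 * 𝔣) : ℝ) * Ideal.absNorm (differentIdeal ℤ (𝓞 K)) / Y ^ d) ^ (m - 1) with hE
  -- the coset sums
  have hcoset : ∀ q : 𝓞 K ⧸ 𝔣, ‖(∑' t : ↥(𝔟 * 𝔣), F ((t : 𝓞 K) + r q)) - MT‖ ≤ E := by
    intro q
    have h := coset_sum hm hgc hgs hG h𝔟𝔣 hY (r q)
    simp only [hF]
    convert h using 4
    push_cast
    rfl
  -- finite support: all sums are over the finite set of `a` with `F a ≠ 0`
  have hfin : (Function.support F).Finite := by
    -- `F a ≠ 0` forces `a/Y` into the compact support cube, and `𝓞_K` is discrete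
    have hcpt := hasCompactSupport_prodWeight (K := K) hgs
    obtain ⟨ρ, hρ⟩ := hcpt.isCompact.isBounded.subset_closedBall 0
    refine Set.Finite.subset (CastilloEtAl2015.finite_cbox (K := K) (fun _ => -(Y * ρ + 1))
      (fun _ => Y * ρ)) ?_
    intro a ha
    rw [Function.mem_support] at ha
    have hmem : (fun w => remb K ((a : 𝓞 K) : K) w / Y) ∈ Metric.closedBall (0 : RP → ℝ) ρ :=
      hρ (subset_tsupport _ (Function.mem_support.2 ha))
    rw [Metric.mem_closedBall, dist_zero_right] at hmem
    intro w
    have h1 : |remb K ((a : 𝓞 K) : K) w / Y| ≤ ρ := by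
      have := norm_le_pi_norm (fun w => remb K ((a : 𝓞 K) : K) w / Y) w
      rw [Real.norm_eq_abs] at this
      exact this.trans hmem
    rw [abs_div, abs_of_pos hY, div_le_iff₀ hY, mul_comm, abs_le] at h1
    change remb K (a : K) w ∈ Set.Ioc (-(Y * ρ + 1)) (Y * ρ)
    exact ⟨by linarith [h1.1], h1.2⟩
  set S : Finset (𝓞 K) := hfin.toFinset with hS
  have hSmem : ∀ a, F a ≠ 0 → a ∈ S := fun a ha => by
    rw [hS, Set.Finite.mem_toFinset]; exact ha
  -- Step 1: the sum over `𝔟` as a finite sum, grouped by classes mod `𝔣`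
  have hstep1 : ∑' a : 𝔟, unitValue χ (Ideal.Quotient.mk 𝔣 (a : 𝓞 K)) * F a =
      ∑ q : 𝓞 K ⧸ 𝔣, unitValue χ q *
        ∑ a ∈ (S.filter (· ∈ 𝔟)).filter (fun a => Ideal.Quotient.mk 𝔣 a = q), F a := by
    rw [tsum_ideal_eq_sum (F := fun a => unitValue χ (Ideal.Quotient.mk 𝔣 a) * F a) S
        (fun a _ h => hSmem a (right_ne_zero_of_mul h)),
      ← Finset.sum_fiberwise (S.filter (· ∈ 𝔟)) (fun a => Ideal.Quotient.mk 𝔣 a)]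
    refine Finset.sum_congr rfl fun q _ => ?_
    rw [Finset.mul_sum]
    refine Finset.sum_congr rfl fun a ha => ?_
    rw [(Finset.mem_filter.1 ha).2]
  -- Step 2: each class sum is a coset sum over `𝔟𝔣`
  have hstep2 : ∀ q : 𝓞 K ⧸ 𝔣,
      ∑ a ∈ (S.filter (· ∈ 𝔟)).filter (fun a => Ideal.Quotient.mk 𝔣 a = q), F a =
        ∑' t : ↥(𝔟 * 𝔣), F ((t : 𝓞 K) + r q) := by
    intro q
    rw [tsum_ideal_eq_sum (𝔞 := 𝔟 * 𝔣) (F := fun t => F (t + r q)) (S.image fun a => a - r q)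
      (fun t _ h => Finset.mem_image.2 ⟨t + r q, hSmem _ h, add_sub_cancel_right _ _⟩)]
    have hset : (S.filter (· ∈ 𝔟)).filter (fun a => Ideal.Quotient.mk 𝔣 a = q) =
        (((S.image fun a => a - r q).filter (· ∈ 𝔟 * 𝔣))).image fun t => t + r q := by
      ext a
      simp only [Finset.mem_filter, Finset.mem_image]
      constructor
      · rintro ⟨⟨haS, ha𝔟⟩, haq⟩
        refine ⟨a - r q, ⟨⟨a, haS, rfl⟩, ?_⟩, sub_add_cancel _ _⟩
        rw [Ideal.mul_eq_inf_of_isCoprime hcop, Submodule.mem_inf]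
        refine ⟨𝔟.sub_mem ha𝔟 (hr𝔟 q), ?_⟩
        rw [← Ideal.Quotient.eq, haq, hrq]
      · rintro ⟨t, ⟨⟨a', ha'S, rfl⟩, ht⟩, rfl⟩
        rw [sub_add_cancel]
        rw [Ideal.mul_eq_inf_of_isCoprime hcop, Submodule.mem_inf] at ht
        refine ⟨⟨ha'S, ?_⟩, ?_⟩
        · have := 𝔟.add_mem ht.1 (hr𝔟 q)
          rwa [sub_add_cancel] at this
        · have h2 : Ideal.Quotient.mk 𝔣 (a' - r q) = 0 := Ideal.Quotient.eq_zero_iff_mem.2 ht.2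
          rw [map_sub, sub_eq_zero] at h2
          rw [h2, hrq]
    rw [hset, Finset.sum_image fun _ _ _ _ h => add_right_cancel h]
  -- Step 3: main terms cancel
  have hstep3 : ∑' a : 𝔟, unitValue χ (Ideal.Quotient.mk 𝔣 (a : 𝓞 K)) * F a =
      ∑ q : 𝓞 K ⧸ 𝔣, unitValue χ q * ((∑' t : ↥(𝔟 * 𝔣), F ((t : 𝓞 K) + r q)) - MT) := by
    rw [hstep1]
    simp_rw [hstep2, mul_sub]
    rw [Finset.sum_sub_distrib, ← Finset.sum_mul, sum_unitValue_eq_zero hχ, zero_mul, sub_zero]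
  -- Step 4: estimate
  have hcard : (Fintype.card (𝓞 K ⧸ 𝔣) : ℝ) = Ideal.absNorm 𝔣 := by
    rw [Ideal.absNorm_apply, Submodule.cardQuot_apply, Nat.card_eq_fintype_card]
  calc ‖∑' a : 𝔟, unitValue χ (Ideal.Quotient.mk 𝔣 (a : 𝓞 K)) * F a‖
      = ‖∑ q : 𝓞 K ⧸ 𝔣, unitValue χ q * ((∑' t : ↥(𝔟 * 𝔣), F ((t : 𝓞 K) + r q)) - MT)‖ := by
        rw [hstep3]
    _ ≤ ∑ q : 𝓞 K ⧸ 𝔣, ‖unitValue χ q * ((∑' t : ↥(𝔟 * 𝔣), F ((t : 𝓞 K) + r q)) - MT)‖ :=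
        norm_sum_le _ _
    _ ≤ ∑ _q : 𝓞 K ⧸ 𝔣, E := Finset.sum_le_sum fun q _ => by
        rw [norm_mul]
        calc ‖unitValue χ q‖ * ‖(∑' t : ↥(𝔟 * 𝔣), F ((t : 𝓞 K) + r q)) - MT‖ ≤ 1 * E :=
              mul_le_mul (norm_unitValue_le χ q) (hcoset q) (norm_nonneg _) zero_le_one
          _ = E := one_mul E
    _ = Ideal.absNorm 𝔣 * E := by rw [Finset.sum_const, Finset.card_univ, nsmul_eq_mul, hcard]

end TypeOne

end Literature.NumberTheory.Sieve.SmoothCoset
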